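import Summits.BirchSwinnertonDyer.Rank1Residual.Additive.X3ThreeLineDatum
import Summits.BirchSwinnertonDyer.Rank1Residual.Additive.N10LowerHalfStatements
import Literature.NumberTheory.EllipticCurves.Isogeny
import HarnessLib
import HarnessLib.Audit.Tags

/-!
# The CASE-1 MEMBER predicate of the X3♯(G-ord, `e = 2`) end states (cell `bsd-addord`; vocabulary for
# the ledger route on rung K1, D-0059) — definitions only, nothing asserted

The cell's rank-`0` end states on the reducible semistable-twist rows
(`ClassX3Gord.missingLowerBoundAt_rankZero_of_facts_*`, `…_three_…_of_lineDatum_*`, files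
`Additive/X3BranchGordEndStateOfFacts.lean`, `Additive/X3ThreeLineDatumEndState.lean`,
`Additive/X3BranchGordEndStateIntrinsic.lean`) take, besides PUBLISHED named facts and the class
binders, a per-pair LINE DATUM: at `p ≥ 5` a rational `p`-line `Φ₀ ≤ E[p]` RAMIFIED at `p`, EVEN, whose
`χ_{p*}`-twist is ramified at `p` (Greenberg–Vatsal 2000 "Case 1": `φ` ramified-even or
unramified-odd, here transported along the quadratic twist); at `p = 3` the predicate
`X3LineDatumThree` (`Additive/X3ThreeLineDatum.lean`). Inside an isogeny class the datum holds on
SOME member (the "Case-1 member" of the cell's member tables `bsd-addord-twist-booking-members*.tsv`,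
kernel records `X3ThreeLineDatumRecords.x3LineDatumThree_<label>` at `p = 3`) and `BSD(E,p)` is then
transported to every member by Cassels' isogeny invariance (`N10.missingLowerBoundAt_of_isIsogenous_of_bsdp`).
This file names the two predicates so that route items can quantify over them:
`CaseOneDatum W' p` (the datum at a curve) and `HasCaseOneMember W p` (some globally minimal `W'`
isogenous to `W` lies on X3♯(G-ord) with semistability index `2` and carries the datum). Classes with
NO Case-1 member exist (e.g. `W = V ⊗ χ_{p*}` with `V[p]^{ss} ∋` the trivial character: `V = 11a1`,
`p = 5`); on them the Greenberg–Vatsal transport is unavailable (μ-invariant territory).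
References: Greenberg–Vatsal, Invent. Math. 142 (2000) §2 p. 28, §3 Thm. (3.12) [GreenbergVatsal2000];
Milne, Arithmetic Duality Theorems, Thm. I.7.3 (Cassels) [MilneADT2006].
-/

noncomputable section

open scoped Classical

open WeierstrassCurve Literature.NumberTheory.EllipticCurves
  Literature.NumberTheory.EllipticCurves.Rank1Residual
  Literature.NumberTheory.GaloisRepresentations
  IsDedekindDomain NumberField

namespace Summit.BirchSwinnertonDyer.Rank1Residual.Additive

/-- **The per-pair line datum** of the X3♯(G-ord, `e = 2`) end states at a curve `W'` and a prime `p`: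
at `p = 3`, `X3LineDatumThree W'`; at `p ≥ 5`, a rational `p`-line `Φ₀ ≤ W'[p]` ramified at `p`, even,
whose `χ_{p*}`-twist is ramified at `p` (verbatim the binders `hΦ`, `hram0`, `heven`, `hram` of
`ClassX3Gord.missingLowerBoundAt_rankZero_of_facts_of_nonAnomalous`). A predicate; nothing asserted.
[cite: GreenbergVatsal2000, §2 p. 28 (the subgroup Φ and its character φ; Case 1)] -/
def CaseOneDatum (W' : WeierstrassCurve ℚ) (p : ℕ) [Fact p.Prime] : Prop :=
  (p = 3 ∧ X3LineDatumThree W') ∨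
  (5 ≤ p ∧ ∃ Φ₀ : AddSubgroup (W'.geomTorsion (p : ℤ)), IsRationalLine W' p Φ₀ ∧
    ¬ LineUnramifiedAt W' p Φ₀ ∧ LineEven W' p Φ₀ ∧
    ∀ (K : Type) [Field K] [NumberField K] [(galRange (K := ℚ) K).Normal],
      Module.finrank ℚ K = 2 → (∃ θ : K, θ ^ 2 = algebraMap ℚ K ((-1) ^ (p / 2) * p)) →
      ¬ ∀ v : HeightOneSpectrum (𝓞 ℚ), ((p : ℕ) : 𝓞 ℚ) ∈ v.asIdeal →
        ∀ 𝔓 ∈ v.primesAbove, ∀ σ ∈ 𝔓.inertia (Field.absoluteGaloisGroup ℚ), ∀ P ∈ Φ₀,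
          σ • P = (if σ ∈ galRange (K := ℚ) K then P else -P))

/-- **`W` has a Case-1 member at `p`**: some globally minimal elliptic `W'` isogenous to `W` over `ℚ`
lies on X3♯(G-ord) (`ClassX3Gord W' p`) with semistability index `2` and carries `CaseOneDatum W' p`.
A predicate; nothing asserted. [cite: GreenbergVatsal2000, §2 p. 28] [cite: MilneADT2006, Thm. I.7.3] -/
def HasCaseOneMember (W : WeierstrassCurve ℚ) (p : ℕ) [Fact p.Prime] : Prop :=
  ∃ (W' : WeierstrassCurve ℚ) (_ : W'.IsElliptic) (_ : W'.IsGloballyMinimal),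
    IsIsogenous W W' ∧ ClassX3Gord W' p ∧ semistabilityIndex W' p = 2 ∧ CaseOneDatum W' p

end Summit.BirchSwinnertonDyer.Rank1Residual.Additive

end
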